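import Summits.Ventures.PercRepro.SevenThreeCyclic

/-!
# PercRepro — the `(7,3)` cell: the natural-number rank of a finset (p3, gen 16)

`nrk M A = (M.eRk A).toNat` is the rank of a finset as a natural number (`coe_nrk`: it is the `eRk`), with the
bookkeeping the series-class analysis of the `(7,3)` cell needs in `ℕ` (so that `omega` closes the arithmetic):
monotonicity, submodularity (`nrk_submod`), `nrk A ≤ nrk (A ∖ V) + |V|`, the one-point drops, and the coloops / cyclic
part of `SevenThreeCyclic.lean` in rank form (`mem_coloopsOf_iff_nrk`, `mem_cyclicPart_iff_nrk`,
`nrk_erase_add_one_of_coloop`: a coloop of `A` drops the rank of every subset of `A` containing it by exactly one).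
(`P3-C025-seven-three-plan.md` §9 (R2)–(R4).)
-/

namespace PercRepro

namespace SevenThree

open Finset ThmH SixThree

variable {α : Type*} [DecidableEq α] {M : Matroid α} [M.Finite]

/-- The rank of a finset as a natural number. -/
noncomputable def nrk (M : Matroid α) [M.Finite] (A : Finset α) : ℕ := (M.eRk (A : Set α)).toNat

omit [DecidableEq α] in
/-- The rank of a finset is finite: `M.eRk A = nrk M A`. -/
theorem coe_nrk (A : Finset α) : ((nrk M A : ℕ) : ℕ∞) = M.eRk (A : Set α) := by
  unfold nrk
  obtain ⟨k, hk, -⟩ := eRk_eq_nat M A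
  rw [hk, ENat.toNat_coe]

omit [DecidableEq α] in
/-- `nrk` from an `eRk` equation. -/
theorem nrk_eq_of_eRk {A : Finset α} {k : ℕ} (h : M.eRk (A : Set α) = k) : nrk M A = k := by
  have := coe_nrk (M := M) A
  rw [h] at this
  exact_mod_cast this

omit [DecidableEq α] in
/-- `nrk M A ≤ |A|`. -/
theorem nrk_le_card (A : Finset α) : nrk M A ≤ A.card := by
  have h := M.eRk_le_encard (A : Set α)
  rw [Set.encard_coe_eq_coe_finsetCard, ← coe_nrk] at h
  exact_mod_cast h

omit [DecidableEq α] in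
/-- Monotonicity of `nrk`. -/
theorem nrk_mono {A B : Finset α} (h : A ⊆ B) : nrk M A ≤ nrk M B := by
  have := M.eRk_mono (Finset.coe_subset.2 h)
  rw [← coe_nrk, ← coe_nrk] at this
  exact_mod_cast this

/-- Submodularity of `nrk`. -/
theorem nrk_submod (A B : Finset α) : nrk M (A ∩ B) + nrk M (A ∪ B) ≤ nrk M A + nrk M B := by
  have := M.eRk_submod (A : Set α) (B : Set α)
  rw [← Finset.coe_inter, ← Finset.coe_union, ← coe_nrk, ← coe_nrk, ← coe_nrk, ← coe_nrk] at this
  exact_mod_cast this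

/-- `nrk A ≤ nrk (A ∖ V) + |V|`. -/
theorem nrk_le_nrk_sdiff_add_card (A V : Finset α) : nrk M A ≤ nrk M (A \ V) + V.card := by
  have h1 : A ⊆ (A \ V) ∪ V := by
    intro e he
    rw [Finset.mem_union, Finset.mem_sdiff]
    by_cases hv : e ∈ V
    · exact Or.inr hv
    · exact Or.inl ⟨he, hv⟩
  have h2 := M.eRk_union_le_eRk_add_encard ((A \ V : Finset α) : Set α) (V : Set α)
  rw [← Finset.coe_union, Set.encard_coe_eq_coe_finsetCard, ← coe_nrk, ← coe_nrk] at h2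
  have h3 : nrk M A ≤ nrk M ((A \ V) ∪ V) := nrk_mono h1
  have h4 : nrk M ((A \ V) ∪ V) ≤ nrk M (A \ V) + V.card := by exact_mod_cast h2
  omega

/-- `nrk (A.erase e) ≤ nrk A`. -/
theorem nrk_erase_le (A : Finset α) (e : α) : nrk M (A.erase e) ≤ nrk M A :=
  nrk_mono (Finset.erase_subset e A)

/-- `nrk A ≤ nrk (A.erase e) + 1`. -/
theorem nrk_le_nrk_erase_add_one (A : Finset α) (e : α) : nrk M A ≤ nrk M (A.erase e) + 1 := by
  by_cases he : e ∈ A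
  · have := nrk_le_nrk_sdiff_add_card (M := M) A {e}
    rw [Finset.sdiff_singleton_eq_erase, Finset.card_singleton] at this
    exact this
  · rw [Finset.erase_eq_of_notMem he]
    omega

/-- The coloops of `A` in terms of `nrk`: `y ∈ coloopsOf M A ↔ y ∈ A ∧ nrk (A.erase y) + 1 = nrk A`. -/
theorem mem_coloopsOf_iff_nrk {A : Finset α} (hA : A ⊆ gr M) {y : α} :
    y ∈ coloopsOf M A ↔ y ∈ A ∧ nrk M (A.erase y) + 1 = nrk M A := by
  constructor
  · intro hy
    have h := eRk_erase_add_one_of_mem_coloopsOf hA hy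
    rw [← coe_nrk, ← coe_nrk] at h
    exact ⟨(mem_coloopsOf.1 hy).1, by exact_mod_cast h⟩
  · rintro ⟨hyA, h⟩
    rw [mem_coloopsOf]
    refine ⟨hyA, fun hcl => ?_⟩
    have h2 := eRk_insert_eq_of_mem_closure ((Finset.erase_subset y A).trans hA) hcl
    rw [Finset.insert_erase hyA, ← coe_nrk, ← coe_nrk] at h2
    have h3 : nrk M A = nrk M (A.erase y) := by exact_mod_cast h2
    omega

/-- The cyclic part in terms of `nrk`: `e ∈ cyclicPart M A ↔ e ∈ A ∧ nrk (A.erase e) = nrk A`. -/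
theorem mem_cyclicPart_iff_nrk {A : Finset α} (hA : A ⊆ gr M) {e : α} :
    e ∈ cyclicPart M A ↔ e ∈ A ∧ nrk M (A.erase e) = nrk M A := by
  unfold cyclicPart
  rw [Finset.mem_sdiff, mem_coloopsOf_iff_nrk hA]
  have h1 := nrk_erase_le (M := M) A e
  have h2 := nrk_le_nrk_erase_add_one (M := M) A e
  constructor
  · rintro ⟨he, h⟩
    refine ⟨he, ?_⟩
    by_contra hne
    exact h ⟨he, by omega⟩
  · rintro ⟨he, h⟩
    exact ⟨he, fun h' => by omega⟩

/-- A coloop of `A` is a coloop of every subset of `A` containing it: `nrk (B.erase y) + 1 = nrk B`. -/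
theorem nrk_erase_add_one_of_coloop {A B : Finset α} (hA : A ⊆ gr M) (hBA : B ⊆ A) {y : α}
    (hy : y ∈ coloopsOf M A) (hyB : y ∈ B) : nrk M (B.erase y) + 1 = nrk M B := by
  have hyg : y ∈ gr M := hA (coloopsOf_subset M A hy)
  have hcl : y ∉ M.closure ((B.erase y : Finset α) : Set α) := by
    intro h
    apply (mem_coloopsOf.1 hy).2
    apply M.closure_subset_closure _ h
    rw [Finset.coe_subset]
    intro e he
    rw [Finset.mem_erase] at he ⊢
    exact ⟨he.1, hBA he.2⟩
  have h := eRk_insert_eq_succ_of_notMem_closure hyg hcl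
  rw [Finset.insert_erase hyB, ← coe_nrk, ← coe_nrk] at h
  exact_mod_cast h.symm


end SevenThree

end PercRepro
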